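import Summits.FinalStateConjecture.FinalStateConjecture.Theorems.EIHFluxBalanceInertialRecessionStubHigherOrderOmega
import Summits.FinalStateConjecture.FinalStateConjecture.Theorems.EIHFluxBalanceInertialRecessionStubHigherOrderComp

/-!
# Route EIHFluxBalance — `InertialRecession` (E′), line `SketchCleanExcision`, skeleton r13,
# stub `stub_higherOrderSlaving` (EF): the lab-time variations of one painted summand — preparations

Helper file for the crux `stmt-FinalStateConjecture-17403`
(`Summit.FinalStateConjecture.FinalStateConjecture.Theses.EIHFluxBalance.InertialRecession`, E′),
registered stub `stub_higherOrderSlaving` (orders two and three of frozen-vacuum slaving).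

Generic preparations for the variation bounds of `…StubHigherOrderVariation`: jets of a smooth map
along an affine family (`higherOrder_norm_iteratedFDeriv_comp_affine_le`), the derivatives of the
parameter path `s ↦ (a₀, S s, ρ' • (z − c s))` of a painted summand
(`higherOrder_paramPath_derivs`, `higherOrder_norm_paramDir_le`), smoothness of the two-variable
summand field (`higherOrder_contDiffOn_summandField`), and `fderiv` of a scalar multiple on a
neighbourhood (`higherOrder_fderiv_const_smul_of_eqOn`).

No definitions, no named facts, no `sorry`.
-/


set_option linter.dupNamespace false
set_option maxSynthPendingDepth 6
set_option synthInstance.maxHeartbeats 200000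

noncomputable section

namespace Summit.FinalStateConjecture.FinalStateConjecture.Theorems.SublinearIsFree.Slaving

open scoped Topology ContDiff
open Filter Set Function Metric Literature.Geometry.Lorentzian

/-! ### Generic: jets of a smooth map along an affine family -/

section Affine

variable {E P F : Type*} [NormedAddCommGroup E] [NormedSpace ℝ E] [NormedAddCommGroup P]
  [NormedSpace ℝ P] [NormedAddCommGroup F] [NormedSpace ℝ F]

/-- **Jets of `z ↦ Ψ(p₀ + L z)`** are the jets of `Ψ` composed with `L`:
`‖Dᵏ[Ψ(p₀ + L·)](x)‖ ≤ ‖DᵏΨ(p₀ + Lx)‖ ‖L‖ᵏ`. [folklore] -/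
theorem higherOrder_norm_iteratedFDeriv_comp_affine_le {Ψ : P → F} {O : Set P} (hO : IsOpen O)
    (hΨ : ContDiffOn ℝ ∞ Ψ O) (p₀ : P) (L : E →L[ℝ] P) {x : E} (hx : p₀ + L x ∈ O) (k : ℕ) :
    ‖iteratedFDeriv ℝ k (fun z ↦ Ψ (p₀ + L z)) x‖ ≤ ‖iteratedFDeriv ℝ k Ψ (p₀ + L x)‖ * ‖L‖ ^ k := by
  set f : P → F := fun p ↦ Ψ (p + p₀) with hf
  set O' : Set P := (fun p ↦ p + p₀) ⁻¹' O with hO'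
  have hO'o : IsOpen O' := hO.preimage (continuous_id.add continuous_const)
  have hfc : ContDiffOn ℝ ∞ f O' := hΨ.comp (contDiff_id.add contDiff_const).contDiffOn fun p hp ↦ hp
  have hLx : L x ∈ O' := by show L x + p₀ ∈ O; rwa [add_comm]
  have hcomp : (fun z ↦ Ψ (p₀ + L z)) = f ∘ L := by
    funext z; simp only [hf, Function.comp_apply, add_comm]
  have h1 := L.iteratedFDerivWithin_comp_right (f := f) hfc hO'o.uniqueDiffOn
    ((hO'o.preimage L.continuous).uniqueDiffOn) hLx (i := k) (by exact_mod_cast le_top)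
  rw [iteratedFDerivWithin_of_isOpen k (hO'o.preimage L.continuous) hLx,
    iteratedFDerivWithin_of_isOpen k hO'o hLx] at h1
  have h2 : iteratedFDeriv ℝ k f (L x) = iteratedFDeriv ℝ k Ψ (p₀ + L x) := by
    rw [hf, iteratedFDeriv_comp_add_right, add_comm]
  rw [hcomp, h1, h2]
  calc _ ≤ ‖iteratedFDeriv ℝ k Ψ (p₀ + L x)‖ * ∏ _i : Fin k, ‖L‖ :=
        ContinuousMultilinearMap.norm_compContinuousLinearMap_le _ _
    _ = _ := by rw [Finset.prod_const, Finset.card_univ, Fintype.card_fin]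

end Affine

/-! ### The parameter path of a painted summand and its derivatives -/

/-- **Derivatives of the parameter path** `s ↦ (a₀, S s, ρ' • (z − c s))`:
`(0, S⁽ᵏ⁾, −ρ' • c⁽ᵏ⁾)` for `k = 1, 2, 3`, with norm `≤ ‖S⁽ᵏ⁾‖ + ‖c⁽ᵏ⁾‖` when `|ρ'| ≤ 1`. [folklore] -/
theorem higherOrder_paramPath_derivs (a₀ ρ' : ℝ) {S : ℝ → E4 →L[ℝ] E4} {c : ℝ → E4}
    (hS : ContDiff ℝ ∞ S) (hc : ContDiff ℝ ∞ c) (z : E4) (s : ℝ) :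
    ContDiff ℝ ∞ (fun r ↦ ((a₀, S r, ρ' • (z - c r)) : ℝ × (E4 →L[ℝ] E4) × E4)) ∧
    deriv (fun r ↦ ((a₀, S r, ρ' • (z - c r)) : ℝ × (E4 →L[ℝ] E4) × E4)) s =
      ((0 : ℝ), deriv S s, -(ρ' • deriv c s)) ∧
    iteratedDeriv 2 (fun r ↦ ((a₀, S r, ρ' • (z - c r)) : ℝ × (E4 →L[ℝ] E4) × E4)) s =
      ((0 : ℝ), iteratedDeriv 2 S s, -(ρ' • iteratedDeriv 2 c s)) ∧
    iteratedDeriv 3 (fun r ↦ ((a₀, S r, ρ' • (z - c r)) : ℝ × (E4 →L[ℝ] E4) × E4)) s =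
      ((0 : ℝ), iteratedDeriv 3 S s, -(ρ' • iteratedDeriv 3 c s)) := by
  have hw : ContDiff ℝ ∞ (fun r ↦ ρ' • (z - c r)) := (contDiff_const.sub hc).const_smul ρ'
  have hγ : ContDiff ℝ ∞ (fun r ↦ ((a₀, S r, ρ' • (z - c r)) : ℝ × (E4 →L[ℝ] E4) × E4)) :=
    contDiff_const.prodMk (hS.prodMk hw)
  -- derivatives of the position component
  have hdw : ∀ r, HasDerivAt (fun r ↦ ρ' • (z - c r)) (-(ρ' • deriv c r)) r := fun r ↦ by
    have h : HasDerivAt (fun r ↦ ρ' • (z - c r)) (ρ' • (0 - deriv c r)) r :=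
      ((hasDerivAt_const r z).sub ((hc.differentiable (by simp) r).hasDerivAt)).const_smul ρ'
    exact h.congr_deriv (by rw [zero_sub, smul_neg])
  have hw1 : deriv (fun r ↦ ρ' • (z - c r)) = fun r ↦ -(ρ' • deriv c r) := funext fun r ↦ (hdw r).deriv
  have hdc1 : ∀ r, HasDerivAt (deriv c) (iteratedDeriv 2 c r) r := fun r ↦ by
    have h := higherOrder_hasDerivAt_iteratedDeriv hc 1 r; rwa [iteratedDeriv_one] at h
  have hdc2 : ∀ r, HasDerivAt (iteratedDeriv 2 c) (iteratedDeriv 3 c r) r := fun r ↦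
    higherOrder_hasDerivAt_iteratedDeriv hc 2 r
  have hdw1 : ∀ r, HasDerivAt (fun r ↦ -(ρ' • deriv c r)) (-(ρ' • iteratedDeriv 2 c r)) r := fun r ↦
    ((hdc1 r).const_smul ρ').neg
  have hw2 : iteratedDeriv 2 (fun r ↦ ρ' • (z - c r)) = fun r ↦ -(ρ' • iteratedDeriv 2 c r) := by
    rw [iteratedDeriv_succ, iteratedDeriv_one, hw1]
    exact funext fun r ↦ (hdw1 r).deriv
  have hdw2 : ∀ r, HasDerivAt (fun r ↦ -(ρ' • iteratedDeriv 2 c r)) (-(ρ' • iteratedDeriv 3 c r)) r := fun r ↦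
    ((hdc2 r).const_smul ρ').neg
  -- derivatives of the frame component
  have hdS : ∀ r, HasDerivAt S (deriv S r) r := fun r ↦ (hS.differentiable (by simp) r).hasDerivAt
  have hdS1 : ∀ r, HasDerivAt (deriv S) (iteratedDeriv 2 S r) r := fun r ↦ by
    have h := higherOrder_hasDerivAt_iteratedDeriv hS 1 r; rwa [iteratedDeriv_one] at h
  have hdS2 : ∀ r, HasDerivAt (iteratedDeriv 2 S) (iteratedDeriv 3 S r) r := fun r ↦
    higherOrder_hasDerivAt_iteratedDeriv hS 2 r
  -- assemble
  have e1 : ∀ r, HasDerivAt (fun r ↦ ((a₀, S r, ρ' • (z - c r)) : ℝ × (E4 →L[ℝ] E4) × E4))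
      ((0 : ℝ), deriv S r, -(ρ' • deriv c r)) r := fun r ↦
    (hasDerivAt_const r a₀).prodMk ((hdS r).prodMk (hdw r))
  have e1f : deriv (fun r ↦ ((a₀, S r, ρ' • (z - c r)) : ℝ × (E4 →L[ℝ] E4) × E4)) =
      fun r ↦ ((0 : ℝ), deriv S r, -(ρ' • deriv c r)) := funext fun r ↦ (e1 r).deriv
  have e2 : ∀ r, HasDerivAt (fun r ↦ (((0 : ℝ), deriv S r, -(ρ' • deriv c r)) : ℝ × (E4 →L[ℝ] E4) × E4))
      ((0 : ℝ), iteratedDeriv 2 S r, -(ρ' • iteratedDeriv 2 c r)) r := fun r ↦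
    (hasDerivAt_const r (0 : ℝ)).prodMk ((hdS1 r).prodMk (hdw1 r))
  have e2f : iteratedDeriv 2 (fun r ↦ ((a₀, S r, ρ' • (z - c r)) : ℝ × (E4 →L[ℝ] E4) × E4)) =
      fun r ↦ ((0 : ℝ), iteratedDeriv 2 S r, -(ρ' • iteratedDeriv 2 c r)) := by
    rw [iteratedDeriv_succ, iteratedDeriv_one, e1f]; exact funext fun r ↦ (e2 r).deriv
  have e3 : HasDerivAt (fun r ↦ (((0 : ℝ), iteratedDeriv 2 S r, -(ρ' • iteratedDeriv 2 c r)) :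
      ℝ × (E4 →L[ℝ] E4) × E4)) ((0 : ℝ), iteratedDeriv 3 S s, -(ρ' • iteratedDeriv 3 c s)) s :=
    (hasDerivAt_const s (0 : ℝ)).prodMk ((hdS2 s).prodMk (hdw2 s))
  refine ⟨hγ, (e1 s).deriv, by rw [e2f], ?_⟩
  rw [iteratedDeriv_succ, e2f, e3.deriv]

/-- Norm of a parameter direction `(0, A, −ρ' • w)` with `|ρ'| ≤ 1`. [folklore] -/
theorem higherOrder_norm_paramDir_le {ρ' : ℝ} (hρ' : |ρ'| ≤ 1) (A : E4 →L[ℝ] E4) (w : E4) :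
    ‖(((0 : ℝ), A, -(ρ' • w)) : ℝ × (E4 →L[ℝ] E4) × E4)‖ ≤ ‖A‖ + ‖w‖ := by
  simp only [Prod.norm_mk, norm_zero, norm_neg, norm_smul, Real.norm_eq_abs]
  refine max_le (by positivity) (max_le (le_add_of_nonneg_right (norm_nonneg _)) ?_)
  calc |ρ'| * ‖w‖ ≤ 1 * ‖w‖ := mul_le_mul_of_nonneg_right hρ' (norm_nonneg _)
    _ = ‖w‖ := one_mul _
    _ ≤ ‖A‖ + ‖w‖ := le_add_of_nonneg_left (norm_nonneg _)

/-- **The two-variable summand field is smooth near a good point.** [folklore] -/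
theorem higherOrder_contDiffOn_summandField (M a₀ ρ' : ℝ) {S : ℝ → E4 →L[ℝ] E4} {c : ℝ → E4}
    (hS : ContDiff ℝ ∞ S) (hc : ContDiff ℝ ∞ c) :
    IsOpen {q : ℝ × E4 | 0 < Kerr.radius a₀ (S q.1 (ρ' • (q.2 - c q.1)))} ∧
    ContDiffOn ℝ ∞ (fun q : ℝ × E4 ↦ M • (fun p : ℝ × (E4 →L[ℝ] E4) × E4 ↦
      (Kerr.bilin 1 p.1 (p.2.1 p.2.2) - Minkowski.bilin).bilinearComp p.2.1 p.2.1) (a₀, S q.1, ρ' • (q.2 - c q.1)))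
      {q : ℝ × E4 | 0 < Kerr.radius a₀ (S q.1 (ρ' • (q.2 - c q.1)))} := by
  have hmap : ContDiff ℝ ∞ (fun q : ℝ × E4 ↦ ((a₀, S q.1, ρ' • (q.2 - c q.1)) : ℝ × (E4 →L[ℝ] E4) × E4)) :=
    contDiff_const.prodMk ((hS.comp contDiff_fst).prodMk ((contDiff_snd.sub (hc.comp contDiff_fst)).const_smul ρ'))
  have hpre : {q : ℝ × E4 | 0 < Kerr.radius a₀ (S q.1 (ρ' • (q.2 - c q.1)))} =
      (fun q : ℝ × E4 ↦ ((a₀, S q.1, ρ' • (q.2 - c q.1)) : ℝ × (E4 →L[ℝ] E4) × E4)) ⁻¹'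
        {p : ℝ × (E4 →L[ℝ] E4) × E4 | 0 < Kerr.radius p.1 (p.2.1 p.2.2)} := rfl
  refine ⟨by rw [hpre]; exact higherOrder_isOpen_omegaDomain.preimage hmap.continuous, ?_⟩
  exact (higherOrder_contDiffOn_omega.comp hmap.contDiffOn fun q hq ↦ hq).const_smul M

/-! ### `fderiv` of a scalar multiple on a neighbourhood -/

/-- Scalar multiples and `fderiv` on a neighbourhood. [folklore] -/
theorem higherOrder_fderiv_const_smul_of_eqOn {E F : Type*} [NormedAddCommGroup E] [NormedSpace ℝ E]
    [NormedAddCommGroup F] [NormedSpace ℝ F] {g f : E → F} {U : Set E} (hU : IsOpen U) {x : E}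
    (hx : x ∈ U) (c : ℝ) (hf : DifferentiableAt ℝ f x) (h : ∀ z ∈ U, g z = c • f z) :
    fderiv ℝ g x = c • fderiv ℝ f x := by
  have heq : g =ᶠ[𝓝 x] fun z ↦ c • f z := by
    filter_upwards [hU.mem_nhds hx] with z hz using h z hz
  rw [heq.fderiv_eq]
  exact (hf.hasFDerivAt.const_smul c).fderiv

/-- **Registered one-line carrier form** (`higherOrder_paramPath_EF`) of
`higherOrder_paramPath_derivs`. [folklore] -/
theorem higherOrder_paramPath_EF : ∀ (a₀ ρ' : ℝ) {S : ℝ → E4 →L[ℝ] E4} {c : ℝ → E4}, ContDiff ℝ ((⊤ : ℕ∞) : WithTop ℕ∞) S → ContDiff ℝ ((⊤ : ℕ∞) : WithTop ℕ∞) c → ∀ (z : E4) (s : ℝ), ContDiff ℝ ((⊤ : ℕ∞) : WithTop ℕ∞) (fun r ↦ ((a₀, S r, ρ' • (z - c r)) : ℝ × (E4 →L[ℝ] E4) × E4)) ∧ deriv (fun r ↦ ((a₀, S r, ρ' • (z - c r)) : ℝ × (E4 →L[ℝ] E4) × E4)) s = ((0 : ℝ), deriv S s, -(ρ' • deriv c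 s)) ∧ iteratedDeriv 2 (fun r ↦ ((a₀, S r, ρ' • (z - c r)) : ℝ × (E4 →L[ℝ] E4) × E4)) s = ((0 : ℝ), iteratedDeriv 2 S s, -(ρ' • iteratedDeriv 2 c s)) ∧ iteratedDeriv 3 (fun r ↦ ((a₀, S r, ρ' • (z - c r)) : ℝ × (E4 →L[ℝ] E4) × E4)) s = ((0 : ℝ), iteratedDeriv 3 S s, -(ρ' • iteratedDeriv 3 c s)) :=
  fun a₀ ρ' _ _ hS hc z s ↦ higherOrder_paramPath_derivs a₀ ρ' hS hc z s

end Summit.FinalStateConjecture.FinalStateConjecture.Theorems.SublinearIsFree.Slaving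

end
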